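import Literature.MathematicalPhysics.QuantumFieldTheory.Balaban1983to89.B11Eq98WSlotSectCPerLattice
import Literature.MathematicalPhysics.QuantumFieldTheory.Balaban1983to89.B11Eq103H1Complex

/-!
# `Balaban1983to89.B11Eq45HopKernelEquiv` — T. Bałaban, *The variational problem and background fields in renormalization group method for
# lattice gauge theories*, Commun. Math. Phys. **102** (1985) 277–309 [Balaban1985Variational], (45)–(46) p. 285: THE H-KERNELS `H(b, y′)` AND THE
# CARRIER-TYPED OPERATORS `|·|_{(−0)} → (115)` ARE THE SAME DATA — `Hop` is a BIJECTION (the (L4) «kernel road» of the pub-balaban NE9 chain IS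
# the operator road), and the NE9 leaf-01 lineage's `∀ k_H` per-lattice letters ((regime) `B11Eq44RegimePerLattice`, (assembly)
# `B11Eq98WSlotSectCPerLattice`) RE-READ FOR EVERY carrier-typed `H`, in particular the owner's (L6) letter `H₁ = H1LatticeCLM …`

statement-level skeleton of published theorems with citation tags; proofs where landed; nothing here is a claim about the Yang–Mills mass gap

PDF held: `paper:balaban1985-cmp102-variational-background` (journal page = PDF page + 276), p. 285; read by this seat (2026-08-22).

THE PRINT (verbatim, text layer p0009 = p. 285 L11–17).  *«The operators Δ, Q and R define the operator H. Let us recall that it is an operator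
defined on configurations B … Thus it has the following properties L_jηQ_jHB = B on Λ_j, RD*HB = 0, (45) and the Theorem 3.12 from [5] implies
|HB| ≤ B₀(Lʲη)⁻¹|B|, |∇HB| ≤ B₀(Lʲη)⁻²|B| on Ω_j. (46)»* — `H` as an OPERATOR on block fields `B`.  Print ALSO handles `H` through its KERNEL: the
entries `H(A′; c, b), c ∈ Λ_j, b ∈ Ω₀` of (66) p. 288, whose decay is [Balaban1985BackgroundPropagators] (3.133) p. 422 ∕ Thm 3.12 (not quoted here).  The
two readings are interchangeable on a finite lattice; this file makes the interchange a theorem for the tree's encodings (ne9-leaf-06 g59's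
pre-read W-1: the kernel display is NOT on p. 285 — corrected before filing).

WHY THIS FILE (cell context).  The tree carries (45)'s `H` in two spellings: the KERNEL ROAD `B11Eq45HOperator.Hop … k_H` ∕ `HopAd … U₀ k_H` (NE9
leaf-03's (L4) reading, an H-kernel `k_H` as DATUM; consumed by the leaf-01 lineage's per-lattice letters `exists_regime_sectC` ∕ `exists_sectC_data` ∕
`exists_WSlot_sectC(_of_contractive)` and by ne9-leaf-05's `NE9CurChartOneInstanceDischarged` §4 `_kernelRoad`), and the OPERATOR ROAD (the owner's
(L6) letter `B11Eq103H1Complex.H1LatticeCLM …`, a continuous linear map of the same type, consumed by `Support/NE9CurChartOfBackground` and (C) §1–§3).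
`B11Eq115KernelOp.jetCLMOf_flatOfJet` already says «the kernel road is onto» for `jetCLMOf`; here it is said for `Hop` ITSELF (whose derived kernel
is `gradKernel`, not `kernelOf (∇′ ∘ ·)`), with the converse (`Hop` is injective), so that every `∀ k_H` statement is a `∀ H` statement and conversely.

WHAT IS PROVED (sorry-free; no `Prop` placeholder; no inequality of the papers asserted).
* §1 (any complete field `𝕜`, finite-dimensional fibre `V`, weight `c`, transporters `R`): **`Hop_kernelOf_flatOfJet`** — for EVERY continuous linear
  `T : NegSize L η levB 0 V →L[𝕜] Space115 L η lev₀ lev₁ (covGrad c R)`, `Hop L η levB lev₀ lev₁ c R (kernelOf (flatOfJet … T)) = T`;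
  **`kernelOf_flatOfJet_Hop`** — `kernelOf (flatOfJet … (Hop … k_H)) = k_H`; hence **`Hop_injective`**, **`Hop_surjective`**, **`Hop_bijective`**,
  **`Hop_eq_iff`** (`Hop … k_H = T ↔ k_H = kernelOf (flatOfJet … T)`: the kernel of a carrier-typed operator is UNIQUE).
* §2 (the printed instance `𝕜 = ℂ`, fibre an algebra `𝔸`, `R(U₀(b))X = U₀XU₀⁻¹`, `c = η⁻¹`): **`HopAd_kernelOf_flatOfJet`**, **`kernelOf_flatOfJet_HopAd`**,
  **`exists_kernel_HopAd_eq`** (`∀ H, ∃ k_H, HopAd … U₀ k_H = H`), **`HopAd_injective`**.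
* §3 AT THE NE9 LETTERS (`Dc := nabla115 η U = covGrad ((η:ℂ)⁻¹) (adTransport U)`, by `rfl`): the leaf-01 lineage's per-lattice letters FOR EVERY
  carrier-typed `H : NegSize (L:ℝ) η levB 0 𝔸 →L[ℂ] Space115 (L:ℝ) η lev₀ lev₁ (nabla115 η U)` — **`exists_sectC_data_of_CLM`** (the Sect. C regime of
  (47) at `(H, Cc …)` with `Prop4Hyp` and analyticity of `Cc`), **`exists_WSlot_sectC_of_CLM`** (the regime FIRST, then the W-slot binders of
  `W80 ρ τ U H (Cc …) ε_C J Δπ` at THAT `ε_C`), **`exists_WSlot_sectC_of_contractive_of_CLM`** (trace slots from `‖τ X‖ ≤ ‖X‖`), and the headline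
  instance **`exists_WSlot_sectC_H1`** at the owner's (L6) letter `H := H1LatticeCLM φ hpos hQ lev₁ (nabla115 η U)` (its `hpos` ∕ `hQ` DISPLAYED — the
  ABSOLUTE RULE; nothing of [Balaban1985BackgroundPropagators] Thm 3.11 asserted).  So ne9-leaf-05's (C) §4 `_kernelRoad` species CONTAINS the H126
  species of (C) §1 ∕ (B) §3: one T23 object, two spellings.
MODEL / DECLARED READINGS.  (M1) carriers: block fields `NegSize L η levB 0 V` (sup size, weight `(L^jη)⁰ = 1`) on an index type `β`; configurations
in `Space115 L η lev₀ lev₁ (covGrad c R)` (the (115) jet norm); `Hop k_H` = the jet-kernel operator of `k_H` with derived kernel `gradKernel c R k_H`.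
(M2) nothing displayed in §1–§2; §3 displays exactly what the re-read letters display (the (31)–(32)-window `1 ≤ L`, `α ≤ 1/128`, `hU1`, `hreg`, `1 ≤ lev₀`;
the structure `hU`, `hUn`, `hτ`, `hτs`; the trace slots or `‖τ X‖ ≤ ‖X‖`; at `H₁`: `hpos`, `hQ`).  (M3) every constant PER LATTICE (as in the re-read
letters); NOT «depending on d and L only» (Prop. 3 p. 289, Prop. 4 p. 293); the (46) row-sum letters and [5] Thm 3.12 untouched.
HONEST SCOPE.  [folklore] finite-lattice linear algebra over the cell's OWN encodings (`kernelOf`, `flatOfJet`, `Hop`) + compositions BY NAME; NOT summit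
progress (cell pub-balaban: NE9 NOT PRINTED ∕ NOT PROVED; spine PROVED 0∕9; rung (B)+1 finite torus; NOT infinite volume, NOT mass gap, NOT Clay).
Filed by the pub-balaban NE9 crux-team leaf lineage `b2b-balaban-t4-ne9-formalise-leaf-01` (gen 74); NEW file importing the lineage's
`B11Eq98WSlotSectCPerLattice` and the owner's `B11Eq103H1Complex`; nothing modified.  Net new unproved facts: 0.
-/

noncomputable section

open Finset

namespace Literature.MathematicalPhysics.QuantumFieldTheory.Balaban1983to89.B11Eq45HopKernelEquiv

open B11Eq115Space B11Eq115KernelOp B11Eq45HOperator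
open B9SectCLatticeCarrier (Bond)
open B9Eq33CovDerivVector (covGrad adTransport)

/-! ## §1 `Hop` is a bijection between H-kernels and carrier-typed operators -/

section Generic

variable {d : ℕ} {Pd : Fin d → ℕ} {β : Type*} [Fintype β] [DecidableEq β] {𝕜 : Type*} [NontriviallyNormedField 𝕜] [CompleteSpace 𝕜]
  {V : Type*} [NormedAddCommGroup V] [NormedSpace 𝕜 V] [FiniteDimensional 𝕜 V]
  (L η : ℝ) [Fact (0 < L)] [Fact (0 < η)] (levB : β → ℕ) (lev₀ : Bond d Pd → ℕ) (lev₁ : Bond d Pd × Fin d → ℕ)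
  (c : 𝕜) (R : Bond d Pd → V →ₗ[𝕜] V)

/-- **EVERY CARRIER-TYPED OPERATOR `|·|_{(−0)} → (115)` IS `Hop` OF THE KERNEL OF ITS VALUES**: for every continuous linear
`T : NegSize L η levB 0 V →L[𝕜] Space115 L η lev₀ lev₁ (covGrad c R)`, `Hop … c R (kernelOf (flatOfJet … T)) = T` — print's `H(b, y′)` recovered from
the operator `B ↦ HB` of (45); values agree by `kernelLM_kernelOf` (`f = Σ_y δ_y·f(y)` on the finite lattice) and an element of (115) is determined
by its values. [cite: Balaban1985Variational, (45)–(46) p.285] -/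
theorem Hop_kernelOf_flatOfJet (T : NegSize L η levB 0 V →L[𝕜] Space115 L η lev₀ lev₁ (covGrad c R)) :
    Hop L η levB lev₀ lev₁ c R
        (kernelOf (flatOfJet (levWeight L η levB 0) (levWeight L η lev₀ 1) (levWeight L η lev₁ 2) (covGrad c R) T)) = T := by
  refine ContinuousLinearMap.ext fun B => (JetSup.equiv _ _ (covGrad c R)).injective ?_
  funext b
  rw [equiv_Hop_apply, ← kernelLM_apply, kernelLM_kernelOf]
  rfl

/-- **THE KERNEL OF `Hop k_H`'S VALUES IS `k_H`**: `kernelOf (flatOfJet … (Hop … k_H)) = k_H` (`(Hδ_y·v)(b) = k_H(b, y)v`). [cite: Balaban1985Variational, (45)–(46) p.285] -/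
theorem kernelOf_flatOfJet_Hop (kH : Bond d Pd → β → (V →L[𝕜] V)) :
    kernelOf (flatOfJet (levWeight L η levB 0) (levWeight L η lev₀ 1) (levWeight L η lev₁ 2) (covGrad c R)
        (Hop L η levB lev₀ lev₁ c R kH)) = kH := by
  funext b y
  ext v
  rw [kernelOf_apply]
  show JetSup.equiv _ _ (covGrad c R) (Hop L η levB lev₀ lev₁ c R kH ((NegSup.equiv _ V).symm (Pi.single y v))) b = kH b y v
  rw [equiv_Hop_apply]
  simp only [Equiv.apply_symm_apply]
  rw [Finset.sum_eq_single y]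
  · rw [Pi.single_eq_same]
  · intro y' _ hy'; rw [Pi.single_eq_of_ne hy', map_zero]
  · intro h; exact absurd (Finset.mem_univ y) h

/-- **`Hop` IS INJECTIVE**: two H-kernels with the same operator `B ↦ HB` coincide. [cite: Balaban1985Variational, (45)–(46) p.285] -/
theorem Hop_injective : Function.Injective (Hop L η levB lev₀ lev₁ c R) := fun k k' h => by
  rw [← kernelOf_flatOfJet_Hop L η levB lev₀ lev₁ c R k, h, kernelOf_flatOfJet_Hop]

/-- **`Hop` IS ONTO** the carrier-typed operators. [cite: Balaban1985Variational, (45)–(46) p.285] -/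
theorem Hop_surjective : Function.Surjective (Hop L η levB lev₀ lev₁ c R) := fun T =>
  ⟨_, Hop_kernelOf_flatOfJet L η levB lev₀ lev₁ c R T⟩

/-- **THE KERNEL ROAD IS THE OPERATOR ROAD**: `k_H ↦ Hop … k_H` is a bijection between H-kernels `Bond → β → (V →L V)` and continuous linear maps
`|·|_{(−0)} → (115)`. [cite: Balaban1985Variational, (45)–(46) p.285] -/
theorem Hop_bijective : Function.Bijective (Hop L η levB lev₀ lev₁ c R) :=
  ⟨Hop_injective L η levB lev₀ lev₁ c R, Hop_surjective L η levB lev₀ lev₁ c R⟩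

/-- **UNIQUENESS OF THE KERNEL**: `Hop … k_H = T ↔ k_H = kernelOf (flatOfJet … T)`. [cite: Balaban1985Variational, (45)–(46) p.285] -/
theorem Hop_eq_iff (kH : Bond d Pd → β → (V →L[𝕜] V)) (T : NegSize L η levB 0 V →L[𝕜] Space115 L η lev₀ lev₁ (covGrad c R)) :
    Hop L η levB lev₀ lev₁ c R kH = T ↔
      kH = kernelOf (flatOfJet (levWeight L η levB 0) (levWeight L η lev₀ 1) (levWeight L η lev₁ 2) (covGrad c R) T) := by
  constructor
  · rintro rfl; exact (kernelOf_flatOfJet_Hop L η levB lev₀ lev₁ c R kH).symm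
  · rintro rfl; exact Hop_kernelOf_flatOfJet L η levB lev₀ lev₁ c R T

end Generic

/-! ## §2 The printed instance: `HopAd` (fibre an algebra `𝔸`, `R(U₀(b))X = U₀(b)XU₀(b)⁻¹`, `c = η⁻¹`) -/

section Printed

variable {d : ℕ} {Pd : Fin d → ℕ} {β : Type*} [Fintype β] [DecidableEq β]
  {𝔸 : Type*} [NormedRing 𝔸] [NormedAlgebra ℂ 𝔸] [FiniteDimensional ℂ 𝔸]
  (L η : ℝ) [Fact (0 < L)] [Fact (0 < η)] (levB : β → ℕ) (lev₀ : Bond d Pd → ℕ) (lev₁ : Bond d Pd × Fin d → ℕ) (U₀ : Bond d Pd → 𝔸ˣ)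

/-- **EVERY `H : |·|_{(−0)} → (115)` OF THE PRINTED TYPE IS `HopAd U₀` OF ITS KERNEL.** [cite: Balaban1985Variational, (45)–(46) p.285; Balaban1985BackgroundPropagators, (3.3) p.390] -/
theorem HopAd_kernelOf_flatOfJet (H : NegSize L η levB 0 𝔸 →L[ℂ] Space115 L η lev₀ lev₁ (covGrad ((η : ℂ)⁻¹) (adTransport U₀))) :
    HopAd L η levB lev₀ lev₁ U₀
        (kernelOf (flatOfJet (levWeight L η levB 0) (levWeight L η lev₀ 1) (levWeight L η lev₁ 2)
          (covGrad ((η : ℂ)⁻¹) (adTransport U₀)) H)) = H :=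
  Hop_kernelOf_flatOfJet L η levB lev₀ lev₁ _ _ H

/-- `kernelOf (flatOfJet … (HopAd … U₀ k_H)) = k_H`. [cite: Balaban1985Variational, (45)–(46) p.285] -/
theorem kernelOf_flatOfJet_HopAd (kH : Bond d Pd → β → (𝔸 →L[ℂ] 𝔸)) :
    kernelOf (flatOfJet (levWeight L η levB 0) (levWeight L η lev₀ 1) (levWeight L η lev₁ 2) (covGrad ((η : ℂ)⁻¹) (adTransport U₀))
        (HopAd L η levB lev₀ lev₁ U₀ kH)) = kH :=
  kernelOf_flatOfJet_Hop L η levB lev₀ lev₁ _ _ kH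

/-- **`∀ H, ∃ k_H, HopAd … U₀ k_H = H`** — every `∀ k_H` statement about `HopAd … U₀ k_H` is a `∀ H` statement. [cite: Balaban1985Variational, (45)–(46) p.285] -/
theorem exists_kernel_HopAd_eq (H : NegSize L η levB 0 𝔸 →L[ℂ] Space115 L η lev₀ lev₁ (covGrad ((η : ℂ)⁻¹) (adTransport U₀))) :
    ∃ kH : Bond d Pd → β → (𝔸 →L[ℂ] 𝔸), HopAd L η levB lev₀ lev₁ U₀ kH = H :=
  ⟨_, HopAd_kernelOf_flatOfJet L η levB lev₀ lev₁ U₀ H⟩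

/-- `HopAd U₀` is injective in the kernel. [cite: Balaban1985Variational, (45)–(46) p.285] -/
theorem HopAd_injective : Function.Injective (HopAd L η levB lev₀ lev₁ U₀) :=
  Hop_injective L η levB lev₀ lev₁ _ _

end Printed

/-! ## §3 At the NE9 letters: the leaf-01 lineage's `∀ k_H` per-lattice letters, for EVERY carrier-typed `H` -/

section NE9

open B11Eq44COperatorTorus (Cc prop4Hyp_Cc analyticOnNhd_Cc)
open B11Prop6Scheme (Prop4Hyp)
open B11Eq174Chart (Regime)
open B11Eq111FrakG (nabla115)
open B9Eq319QprimeTorus (fineP)   open B4Sect5Torus (TSite)   open B7Prop1Explicit (U1 Wcx boxVec)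
open B9Eq315QTorus (perCfg cornerSite)
open B13Contraction113 (QuadAnalytic)
open B11Eq80Current (W80)
open B9Eq39Adjoint (posPlaq plaqU)
open B11Eq90V0primeCurrent (Tsh Ucur)
open B9Eq311L2Pairing (WL2)
open B11Eq103H1Complex (SiteL2K BondL2K laplaceALatticeK H1LatticeCLM)
open B11Eq44RegimePerLattice (exists_sectC_data)
open B11Eq98WSlotSectCPerLattice (exists_WSlot_sectC exists_WSlot_sectC_of_contractive)

variable {d : ℕ} {𝔸 : Type*} [NormedRing 𝔸] [NormedAlgebra ℂ 𝔸] [CompleteSpace 𝔸] [NormOneClass 𝔸] [FiniteDimensional ℂ 𝔸]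
  (L : ℕ) (m : Fin d → ℕ) [∀ i, NeZero (fineP L m i)] (η : ℝ) (U : Bond d (fineP L m) → 𝔸ˣ)
  (lev₀ : Bond d (fineP L m) → ℕ) (lev₁ : Bond d (fineP L m) × Fin d → ℕ) (levB : Bond d m → ℕ) [Fact (0 < (L : ℝ))] [Fact (0 < η)]
  (hL : 1 ≤ L) {α : ℝ} (hα : α ≤ 1 / 128)
  (hU1 : ∀ (x : B7Prop1Explicit.Site d) (κ : Fin d), perCfg (fineP L m) U x κ ∈ U1 𝔸)
  (hreg : ∀ (y : TSite d m) (κ : Fin d) (r : Fin d → Fin L),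
    ‖((Wcx L (perCfg (fineP L m) U) (cornerSite L y) κ (boxVec L r) : 𝔸ˣ) : 𝔸) - 1‖ ≤ α)
  (hlev : ∀ b, 1 ≤ lev₀ b)

include hL hα hU1 hreg hlev in
/-- **THE SECT. C DATA AT `(H, Cc …)` FOR EVERY CARRIER-TYPED `H`, PER LATTICE** — `B11Eq44RegimePerLattice.exists_sectC_data` (stated for
`HopAd … U k_H`, any kernel) RE-READ at an arbitrary continuous linear `H : |·|_{(−0)} → (115)`: `∃ b a_C ε_C`, the `Regime` of (47) at `(H, Cc …, a_C, ε_C)`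
∧ `Prop4Hyp (Cc …)` ∧ `Cc` analytic on its ball; displayed: the (31)–(32)-window only.  PER-LATTICE numbers, NOT «d and L only».
[cite: Balaban1985Variational, (45)–(47) p.285, Prop. 3 p.289] -/
theorem exists_sectC_data_of_CLM (H : NegSize (L : ℝ) η levB 0 𝔸 →L[ℂ] Space115 (L : ℝ) η lev₀ lev₁ (nabla115 η U)) :
    ∃ b aC εC : ℝ, 0 ≤ b ∧ 0 < aC ∧ 0 < εC ∧
      Regime H 0 (Cc L m η U lev₀ lev₁ (nabla115 η U) levB) b 0 (2097152 * ((d : ℝ) + 1) ^ 2) (1 / (512 * ((d : ℝ) + 1))) 0 aC εC ∧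
      Prop4Hyp (Cc L m η U lev₀ lev₁ (nabla115 η U) levB) (2097152 * ((d : ℝ) + 1) ^ 2) (1 / (512 * ((d : ℝ) + 1))) ∧
      AnalyticOnNhd ℂ (Cc L m η U lev₀ lev₁ (nabla115 η U) levB)
        {Y : Space115 (L : ℝ) η lev₀ lev₁ (nabla115 η U) | ‖Y‖ < 1 / (512 * ((d : ℝ) + 1))} := by
  classical
  rw [← HopAd_kernelOf_flatOfJet (L : ℝ) η levB lev₀ lev₁ U H]
  exact exists_sectC_data L m η U lev₀ lev₁ levB hL hα hU1 hreg hlev _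

variable [StarRing 𝔸] [StarModule ℂ 𝔸] (ρ : (𝔸 →L[ℂ] ℂ) →L[ℂ] 𝔸) (τ : 𝔸 →L[ℂ] ℂ)
  (hU : ∀ b, (((U b)⁻¹ : 𝔸ˣ) : 𝔸) = star (U b : 𝔸))
  (hUn : ∀ b, ‖(U b : 𝔸)‖ ≤ 1 ∧ ‖(((U b)⁻¹ : 𝔸ˣ) : 𝔸)‖ ≤ 1)
  (hτ : ∀ a b : 𝔸, τ (a * b) = τ (b * a)) (hτs : ∀ a : 𝔸, τ (star a) = starRingEnd ℂ (τ a))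

include hL hα hU1 hreg hlev hU hUn hτ hτs in
/-- **THE (L3) W-SLOT AT THE T-SLOT's OWN `(H, Cc …, ε_C)` FOR EVERY CARRIER-TYPED `H`, PER LATTICE** — `B11Eq98WSlotSectCPerLattice.exists_WSlot_sectC`
RE-READ at an arbitrary `H`: ONE existential block binds the Sect. C regime's scalars FIRST and, under it, the `Wq`-slot binders of
`W80 ρ τ U H (Cc …) ε_C J Δπ` (quadratic-analytic with some `C₄ ≥ 0` on some ball `R′ > 0`, analytic there); displayed: the (31)–(32)-window and the trace ∕
unitarity structure with the (31) trace slots `hW`∕`hW′`.  PER-LATTICE numbers. [cite: Balaban1985Variational, (45)–(47) p.285, Prop. 3 p.289, Prop. 4 (97)–(98) pp.292–293, (80) p.290] -/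
theorem exists_WSlot_sectC_of_CLM
    (hW : ∀ q ∈ posPlaq (TSite d (fineP L m)) (Fin d), ∀ Z : 𝔸,
      ‖(τ : 𝔸 →ₗ[ℂ] ℂ) (Z * (plaqU Tsh (Ucur U) q.2.1 q.2.2 q.1 : 𝔸))‖ ≤ ‖Z‖)
    (hW' : ∀ q ∈ posPlaq (TSite d (fineP L m)) (Fin d), ∀ Z : 𝔸,
      ‖(τ : 𝔸 →ₗ[ℂ] ℂ) (Z * (((plaqU Tsh (Ucur U) q.2.1 q.2.2 q.1)⁻¹ : 𝔸ˣ) : 𝔸))‖ ≤ ‖Z‖)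
    (H : NegSize (L : ℝ) η levB 0 𝔸 →L[ℂ] Space115 (L : ℝ) η lev₀ lev₁ (nabla115 η U))
    (J : NegSize (L : ℝ) η lev₀ 3 𝔸) (Δπ : Space115 (L : ℝ) η lev₀ lev₁ (nabla115 η U) →L[ℂ] NegSize (L : ℝ) η lev₀ 3 𝔸) :
    ∃ b aC εC : ℝ, 0 ≤ b ∧ 0 < aC ∧ 0 < εC ∧
      Regime H 0 (Cc L m η U lev₀ lev₁ (nabla115 η U) levB) b 0 (2097152 * ((d : ℝ) + 1) ^ 2) (1 / (512 * ((d : ℝ) + 1))) 0 aC εC ∧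
      ∃ R' : ℝ, 0 < R' ∧ ∃ C₄ : ℝ, 0 ≤ C₄ ∧
        QuadAnalytic (W80 ρ τ U H (Cc L m η U lev₀ lev₁ (nabla115 η U) levB) εC J Δπ) C₄ R' ∧
        AnalyticOnNhd ℂ (W80 ρ τ U H (Cc L m η U lev₀ lev₁ (nabla115 η U) levB) εC J Δπ)
          {Y : Space115 (L : ℝ) η lev₀ lev₁ (nabla115 η U) | ‖Y‖ < R'} := by
  classical
  rw [← HopAd_kernelOf_flatOfJet (L : ℝ) η levB lev₀ lev₁ U H]
  exact exists_WSlot_sectC L m η U lev₀ lev₁ levB hL hα hU1 hreg hlev ρ τ hU hUn hτ hτs hW hW' _ J Δπ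

include hL hα hU1 hreg hlev hU hUn hτ hτs in
/-- **THE SAME WITH THE TRACE SLOTS FROM STRUCTURE** (`‖τ X‖ ≤ ‖X‖` and `hUn`, `B11Eq98WSlotSectCPerLattice.exists_WSlot_sectC_of_contractive`), FOR
EVERY carrier-typed `H`. [cite: Balaban1985Variational, (45)–(47) p.285, Prop. 3 p.289, Prop. 4 (97)–(98) pp.292–293, (31)–(32) p.282] -/
theorem exists_WSlot_sectC_of_contractive_of_CLM (hτ1 : ∀ X : 𝔸, ‖τ X‖ ≤ ‖X‖)
    (H : NegSize (L : ℝ) η levB 0 𝔸 →L[ℂ] Space115 (L : ℝ) η lev₀ lev₁ (nabla115 η U))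
    (J : NegSize (L : ℝ) η lev₀ 3 𝔸) (Δπ : Space115 (L : ℝ) η lev₀ lev₁ (nabla115 η U) →L[ℂ] NegSize (L : ℝ) η lev₀ 3 𝔸) :
    ∃ b aC εC : ℝ, 0 ≤ b ∧ 0 < aC ∧ 0 < εC ∧
      Regime H 0 (Cc L m η U lev₀ lev₁ (nabla115 η U) levB) b 0 (2097152 * ((d : ℝ) + 1) ^ 2) (1 / (512 * ((d : ℝ) + 1))) 0 aC εC ∧
      ∃ R' : ℝ, 0 < R' ∧ ∃ C₄ : ℝ, 0 ≤ C₄ ∧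
        QuadAnalytic (W80 ρ τ U H (Cc L m η U lev₀ lev₁ (nabla115 η U) levB) εC J Δπ) C₄ R' ∧
        AnalyticOnNhd ℂ (W80 ρ τ U H (Cc L m η U lev₀ lev₁ (nabla115 η U) levB) εC J Δπ)
          {Y : Space115 (L : ℝ) η lev₀ lev₁ (nabla115 η U) | ‖Y‖ < R'} := by
  classical
  rw [← HopAd_kernelOf_flatOfJet (L : ℝ) η levB lev₀ lev₁ U H]
  exact exists_WSlot_sectC_of_contractive L m η U lev₀ lev₁ levB hL hα hU1 hreg hlev ρ τ hU hUn hτ hτs hτ1 _ J Δπ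

open scoped InnerProductSpace in
include hL hα hU1 hreg hlev hU hUn hτ hτs in
/-- **THE HEADLINE INSTANCE — THE W-SLOT AT THE OWNER's (L6) LETTER `H₁ = G₁Q*(QG₁Q*)⁻¹` ([Balaban1985Variational] (45)∕(103),
[Balaban1985BackgroundPropagators] (3.126)), PER LATTICE, STRUCTURE ONLY**: for `H := H1LatticeCLM φ hpos hQ lev₁ (nabla115 η U)` over ANY lattice data
`(c, R, S, Δ₁, Rr, Q, a)` of `laplaceALatticeK` (its positivity `hpos` — Thm 3.11 — and «`Q` onto» `hQ` DISPLAYED, never proved here), ANY `J`, `Δπ`: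
`∃ b a_C ε_C`, the Sect. C `Regime` of (47) at `(H₁, Cc …, a_C, ε_C)` and, under it, `∃ R′ > 0, ∃ C₄ ≥ 0`, `W80 ρ τ U H₁ (Cc …) ε_C J Δπ` quadratic-analytic
and analytic on `‖Y‖ < R′` — the W-side input of ne9-leaf-05's (C) §1 ∕ (B) §3 species, now a COROLLARY of the kernel-road letter (§2): one T23 object,
two spellings. [cite: Balaban1985Variational, (45)–(47) p.285, (103) p.293, Prop. 4 (97)–(98) pp.292–293; Balaban1985BackgroundPropagators, (3.126) p.420, Thm 3.11 p.416] -/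
theorem exists_WSlot_sectC_H1 (hτ1 : ∀ X : 𝔸, ‖τ X‖ ≤ ‖X‖)
    {W : Type*} [NormedAddCommGroup W] [InnerProductSpace ℂ W] [FiniteDimensional ℂ W] (φ : W ≃ₗ[ℂ] 𝔸)
    {c₀ : ℝ} [Fact (0 < c₀)] {wB : Bond d m → ℝ} [Fact (∀ y, 0 < wB y)]
    {c : ℂ} {R S : Bond d (fineP L m) → W →ₗ[ℂ] W} {Δ₁ : BondL2K ℂ d (fineP L m) c₀ W →ₗ[ℂ] BondL2K ℂ d (fineP L m) c₀ W}
    {Rr : SiteL2K ℂ d (fineP L m) c₀ W →ₗ[ℂ] SiteL2K ℂ d (fineP L m) c₀ W} {Q : BondL2K ℂ d (fineP L m) c₀ W →ₗ[ℂ] WL2 ℂ wB W} {a : ℝ}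
    (hpos : ∀ x : BondL2K ℂ d (fineP L m) c₀ W, x ≠ 0 → 0 < RCLike.re ⟪x, laplaceALatticeK c R S Δ₁ Rr Q a x⟫_ℂ) (hQ : Function.Surjective Q)
    (J : NegSize (L : ℝ) η lev₀ 3 𝔸) (Δπ : Space115 (L : ℝ) η lev₀ lev₁ (nabla115 η U) →L[ℂ] NegSize (L : ℝ) η lev₀ 3 𝔸) :
    ∃ b aC εC : ℝ, 0 ≤ b ∧ 0 < aC ∧ 0 < εC ∧
      Regime (H1LatticeCLM (L := (L : ℝ)) (η := η) (lev₀ := lev₀) (levB := levB) φ hpos hQ lev₁ (nabla115 η U)) 0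
        (Cc L m η U lev₀ lev₁ (nabla115 η U) levB) b 0 (2097152 * ((d : ℝ) + 1) ^ 2) (1 / (512 * ((d : ℝ) + 1))) 0 aC εC ∧
      ∃ R' : ℝ, 0 < R' ∧ ∃ C₄ : ℝ, 0 ≤ C₄ ∧
        QuadAnalytic (W80 ρ τ U (H1LatticeCLM (L := (L : ℝ)) (η := η) (lev₀ := lev₀) (levB := levB) φ hpos hQ lev₁ (nabla115 η U))
          (Cc L m η U lev₀ lev₁ (nabla115 η U) levB) εC J Δπ) C₄ R' ∧
        AnalyticOnNhd ℂ (W80 ρ τ U (H1LatticeCLM (L := (L : ℝ)) (η := η) (lev₀ := lev₀) (levB := levB) φ hpos hQ lev₁ (nabla115 η U))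
          (Cc L m η U lev₀ lev₁ (nabla115 η U) levB) εC J Δπ) {Y : Space115 (L : ℝ) η lev₀ lev₁ (nabla115 η U) | ‖Y‖ < R'} :=
  exists_WSlot_sectC_of_contractive_of_CLM L m η U lev₀ lev₁ levB hL hα hU1 hreg hlev ρ τ hU hUn hτ hτs hτ1 _ J Δπ

end NE9

end Literature.MathematicalPhysics.QuantumFieldTheory.Balaban1983to89.B11Eq45HopKernelEquiv

end
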